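import Mathlib

/-!
# `Cruxes/FluctuationComparisonRegPrIntL/Lines/background_form_algebra.lean` — PROVED TOOLKIT (no rows, no sorries) for the PLAN «background_form»
# (ideator ym-r3-idea-1 g24, LENS «control»; `CONTROL-CENSUS-ym-r3-idea-1-g24.md` §8; card `Lines/polymer_form.md` ERRATUM E1)

WHAT THIS IS.  The SENSITIVITY version of the pin algebra of `Lines/polymer_form.lean` §2, for representations whose terms are local in a FINE∕BACKGROUND
configuration `u = M V` (print's form: [Balaban1987RG1] (0.22)–(0.24) pp.256–257, [Balaban1985UV3] p.263 «depends on U₁ restricted to X̃»; typed shape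
`T3AlphaInputsAC.AlphaDataT3.IsLocal`) rather than in the window∕integration variable `V` itself.  Exact cancellation of the terms missing the moved bond
(POLY∘ clause (i)) is replaced by: (L1) a Lipschitz modulus `ℓ X` of the term `T X` in the fine variables of its support, (L2) a discrete-C^{1,1} modulus
`h X` for its mixed second differences, (S1) one-bond sensitivities `s b e` of the map `M` («moving window bond b moves fine variable e by ≤ s b e»), (S2) mixed
second-order sensitivities `s₂ b b' e`.  Conclusions: the one-bond oscillation of `f = c₀ + Σ_X T X ∘ M` is `≤ Σ_X ℓ X · Σ_{e ∈ supp X} s b e`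
(`oneBond_le_of_sensitivity`), and the connected four-point difference is `≤ Σ_X (h X · (Σ_e s b e)(Σ_e s b' e) + ℓ X · Σ_e s₂ b b' e)`
(`fourPoint_le_of_sensitivity`).  Everything is abstract (finite index types, a normed group of fine values, arbitrary window values and window sets)
and kernel-checked; turning the right-hand sides into S2β's `φ_J·e^{−κ·tdist}` is the business of the typed rows POLYBG∘ (moduli `≤ E₀e^{−κ·treeLen X}`,
shape `TermSize`∕`LocCover`) and MINSENS∘ (`s b e ≤ C e^{−κ₁ d(b,e)}`, `s₂ b b' e ≤ C e^{−κ₁(d(b,e)+d(b',e))}`, [Balaban1985Variational]) plus two exponential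
convolutions — NOT done here (plan only, census §8).

HONEST: pure finite-sum algebra; nothing of Bałaban's asserted; no row of any line is proved by this file; 20520 `FluctuationComparisonRegPrIntL` ∕
`YM3TorusSU2` NOT proved; R3 = SU(2) YM₃ on T³ — not d = 4, not infinite volume, not mass gap, not Clay.
-/

namespace Summit.QuantumFields.YangMills.Cruxes.FluctuationComparisonRegPrIntL.RunPairOrgan.BackgroundFormAlgebra

open scoped BigOperators

variable {ι E G H 𝓧 : Type*} [Fintype 𝓧] [NormedAddCommGroup H]

/-- **First order.** One-bond oscillation of `f = c₀ + Σ_X T X ∘ M` from Lipschitz moduli of the terms in their support variables and one-bond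
sensitivities of the background map. -/
theorem oneBond_le_of_sensitivity
    (supp : 𝓧 → Finset E) (T : 𝓧 → (E → H) → ℝ) (ℓ : 𝓧 → ℝ) (M : (ι → G) → (E → H))
    (S : Set (ι → G)) (S' : Set (E → H)) (c₀ : ℝ) (f : (ι → G) → ℝ) (s : ι → E → ℝ)
    (hℓ : ∀ X, 0 ≤ ℓ X)
    (hMS : ∀ V, V ∈ S → M V ∈ S')
    (hlip : ∀ X u u', u ∈ S' → u' ∈ S' → |T X u - T X u'| ≤ ℓ X * ∑ e ∈ supp X, ‖u e - u' e‖)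
    (hrep : ∀ V, V ∈ S → f V = c₀ + ∑ X, T X (M V))
    (b : ι) (V V' : ι → G) (hV : V ∈ S) (hV' : V' ∈ S)
    (hsens : ∀ e, ‖M V e - M V' e‖ ≤ s b e) :
    |f V - f V'| ≤ ∑ X, ℓ X * ∑ e ∈ supp X, s b e := by
  have hdiff : f V - f V' = ∑ X, (T X (M V) - T X (M V')) := by
    rw [hrep V hV, hrep V' hV', Finset.sum_sub_distrib]; ring
  rw [hdiff]
  refine (Finset.abs_sum_le_sum_abs _ _).trans (Finset.sum_le_sum fun X _ => ?_)
  refine (hlip X _ _ (hMS V hV) (hMS V' hV')).trans ?_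
  exact mul_le_mul_of_nonneg_left (Finset.sum_le_sum fun e _ => hsens e) (hℓ X)

/-- **Second order.** The connected four-point difference of `f = c₀ + Σ_X T X ∘ M` over a square of window data
(`V₁₀` = `V₀₀` moved at `b`, `V₀₁` = `V₀₀` moved at `b'`, `V₁₁` = both) from discrete-C^{1,1} moduli of the terms and first- and mixed second-order
sensitivities of the background map. -/
theorem fourPoint_le_of_sensitivity
    (supp : 𝓧 → Finset E) (T : 𝓧 → (E → H) → ℝ) (ℓ h : 𝓧 → ℝ) (M : (ι → G) → (E → H))
    (S : Set (ι → G)) (S' : Set (E → H)) (c₀ : ℝ) (f : (ι → G) → ℝ) (s : ι → E → ℝ) (s₂ : ι → ι → E → ℝ)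
    (hℓ : ∀ X, 0 ≤ ℓ X) (hh : ∀ X, 0 ≤ h X) (hs : ∀ b e, 0 ≤ s b e)
    (hMS : ∀ V, V ∈ S → M V ∈ S')
    (hC11 : ∀ X u₀₀ u₁₀ u₀₁ u₁₁, u₀₀ ∈ S' → u₁₀ ∈ S' → u₀₁ ∈ S' → u₁₁ ∈ S' →
      |T X u₁₁ - T X u₁₀ - T X u₀₁ + T X u₀₀| ≤
        h X * (∑ e ∈ supp X, ‖u₁₀ e - u₀₀ e‖) * (∑ e ∈ supp X, ‖u₀₁ e - u₀₀ e‖) +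
          ℓ X * ∑ e ∈ supp X, ‖u₁₁ e - u₁₀ e - u₀₁ e + u₀₀ e‖)
    (hrep : ∀ V, V ∈ S → f V = c₀ + ∑ X, T X (M V))
    (b b' : ι) (V₀₀ V₁₀ V₀₁ V₁₁ : ι → G) (h₀₀ : V₀₀ ∈ S) (h₁₀ : V₁₀ ∈ S) (h₀₁ : V₀₁ ∈ S) (h₁₁ : V₁₁ ∈ S)
    (hsens₁ : ∀ e, ‖M V₁₀ e - M V₀₀ e‖ ≤ s b e) (hsens₂ : ∀ e, ‖M V₀₁ e - M V₀₀ e‖ ≤ s b' e)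
    (hsens₁₂ : ∀ e, ‖M V₁₁ e - M V₁₀ e - M V₀₁ e + M V₀₀ e‖ ≤ s₂ b b' e) :
    |f V₁₁ - f V₁₀ - f V₀₁ + f V₀₀| ≤
      ∑ X, (h X * (∑ e ∈ supp X, s b e) * (∑ e ∈ supp X, s b' e) + ℓ X * ∑ e ∈ supp X, s₂ b b' e) := by
  have hdiff : f V₁₁ - f V₁₀ - f V₀₁ + f V₀₀ =
      ∑ X, (T X (M V₁₁) - T X (M V₁₀) - T X (M V₀₁) + T X (M V₀₀)) := by
    rw [hrep _ h₁₁, hrep _ h₁₀, hrep _ h₀₁, hrep _ h₀₀]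
    simp only [Finset.sum_add_distrib, Finset.sum_sub_distrib]; ring
  rw [hdiff]
  refine (Finset.abs_sum_le_sum_abs _ _).trans (Finset.sum_le_sum fun X _ => ?_)
  refine (hC11 X _ _ _ _ (hMS _ h₀₀) (hMS _ h₁₀) (hMS _ h₀₁) (hMS _ h₁₁)).trans ?_
  have hA : ∑ e ∈ supp X, ‖M V₁₀ e - M V₀₀ e‖ ≤ ∑ e ∈ supp X, s b e := Finset.sum_le_sum fun e _ => hsens₁ e
  have hB : ∑ e ∈ supp X, ‖M V₀₁ e - M V₀₀ e‖ ≤ ∑ e ∈ supp X, s b' e := Finset.sum_le_sum fun e _ => hsens₂ e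
  have hC : ∑ e ∈ supp X, ‖M V₁₁ e - M V₁₀ e - M V₀₁ e + M V₀₀ e‖ ≤ ∑ e ∈ supp X, s₂ b b' e :=
    Finset.sum_le_sum fun e _ => hsens₁₂ e
  have hB0 : 0 ≤ ∑ e ∈ supp X, ‖M V₀₁ e - M V₀₀ e‖ := Finset.sum_nonneg fun e _ => norm_nonneg _
  have hsB : 0 ≤ ∑ e ∈ supp X, s b e := Finset.sum_nonneg fun e _ => hs b e
  exact add_le_add (mul_le_mul (mul_le_mul_of_nonneg_left hA (hh X)) hB hB0 (mul_nonneg (hh X) hsB))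
    (mul_le_mul_of_nonneg_left hC (hℓ X))

/-- The S2β-shaped corollary: with `U := V₁₁, V := V₀₁, W := V₁₀, Z := V₀₀` the square's connected difference is `(f U − f V) − (f W − f Z)`. -/
theorem fourPoint_rearrange (f : (ι → G) → ℝ) (V₀₀ V₁₀ V₀₁ V₁₁ : ι → G) :
    (f V₁₁ - f V₀₁) - (f V₁₀ - f V₀₀) = f V₁₁ - f V₁₀ - f V₀₁ + f V₀₀ := by ring

end Summit.QuantumFields.YangMills.Cruxes.FluctuationComparisonRegPrIntL.RunPairOrgan.BackgroundFormAlgebra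

/-! ## §2 PROVED: exchanging the pinned sums (one pin, two pins) and the exponential convolution on a pseudo-metric index -/

namespace Summit.QuantumFields.YangMills.Cruxes.FluctuationComparisonRegPrIntL.RunPairOrgan.BackgroundFormAlgebra

open scoped BigOperators

variable {E 𝓧 : Type*} [Fintype E] [Fintype 𝓧]

/-- **One-pin exchange.** `Σ_X ℓ X · Σ_{e ∈ supp X} s e = Σ_e s e · Σ_{X : e ∈ supp X} ℓ X`; hence pinned sums `≤ A` and `Σ_e s e ≤ B` bound the
first-order right-hand side of `oneBond_le_of_sensitivity` by `A · B`. -/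
theorem sum_mul_sum_supp_le [DecidableEq E] (supp : 𝓧 → Finset E) (ℓ : 𝓧 → ℝ) (s : E → ℝ) (A B : ℝ)
    (hs : ∀ e, 0 ≤ s e)
    (hpin : ∀ e, ∑ X ∈ Finset.univ.filter (fun X => e ∈ supp X), ℓ X ≤ A)
    (hB : ∑ e, s e ≤ B) (hA : 0 ≤ A) :
    ∑ X, ℓ X * ∑ e ∈ supp X, s e ≤ A * B := by
  classical
  have hex : ∑ X, ℓ X * ∑ e ∈ supp X, s e = ∑ e, s e * ∑ X ∈ Finset.univ.filter (fun X => e ∈ supp X), ℓ X := by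
    simp_rw [Finset.mul_sum]
    rw [Finset.sum_comm' (s' := fun e => Finset.univ.filter (fun X => e ∈ supp X)) (t' := Finset.univ)]
    · exact Finset.sum_congr rfl fun e _ => Finset.sum_congr rfl fun X _ => mul_comm _ _
    · intro X e; simp
  rw [hex]
  calc ∑ e, s e * ∑ X ∈ Finset.univ.filter (fun X => e ∈ supp X), ℓ X
      ≤ ∑ e, s e * A := Finset.sum_le_sum fun e _ => mul_le_mul_of_nonneg_left (hpin e) (hs e)
    _ = (∑ e, s e) * A := (Finset.sum_mul _ _ _).symm
    _ ≤ B * A := mul_le_mul_of_nonneg_right hB hA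
    _ = A * B := mul_comm _ _

/-- **Two-pin exchange.** `Σ_X h X · (Σ_{e ∈ supp X} s e)(Σ_{e' ∈ supp X} t e') = Σ_{e,e'} s e · t e' · Σ_{X : e, e' ∈ supp X} h X`, so two-pinned bounds
`Σ_{X ∋ e,e'} h X ≤ K e e'` give `≤ Σ_{e,e'} s e · t e' · K e e'` (nonnegative weights). -/
theorem sum_mul_sum_mul_sum_supp_le [DecidableEq E] (supp : 𝓧 → Finset E) (h : 𝓧 → ℝ) (s t : E → ℝ) (K : E → E → ℝ)
    (hs : ∀ e, 0 ≤ s e) (ht : ∀ e, 0 ≤ t e)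
    (hpin : ∀ e e', ∑ X ∈ Finset.univ.filter (fun X => e ∈ supp X ∧ e' ∈ supp X), h X ≤ K e e') :
    ∑ X, h X * (∑ e ∈ supp X, s e) * (∑ e' ∈ supp X, t e') ≤ ∑ e, ∑ e', s e * t e' * K e e' := by
  classical
  have h1 : ∀ X, h X * (∑ e ∈ supp X, s e) * (∑ e' ∈ supp X, t e') = ∑ e ∈ supp X, ∑ e' ∈ supp X, s e * t e' * h X := by
    intro X
    rw [Finset.mul_sum (supp X) s (h X), Finset.sum_mul (supp X) (fun e => h X * s e)]
    refine Finset.sum_congr rfl fun e _ => ?_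
    rw [Finset.mul_sum]
    exact Finset.sum_congr rfl fun e' _ => by ring
  have hex : ∑ X, h X * (∑ e ∈ supp X, s e) * (∑ e' ∈ supp X, t e') =
      ∑ e, ∑ e', s e * t e' * ∑ X ∈ Finset.univ.filter (fun X => e ∈ supp X ∧ e' ∈ supp X), h X := by
    simp_rw [h1]
    rw [Finset.sum_comm' (s' := fun e => Finset.univ.filter (fun X => e ∈ supp X)) (t' := Finset.univ)]
    swap
    · intro X e; simp
    refine Finset.sum_congr rfl fun e _ => ?_
    rw [Finset.sum_comm' (s' := fun e' => Finset.univ.filter (fun X => e ∈ supp X ∧ e' ∈ supp X)) (t' := Finset.univ)]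
    swap
    · intro X e'; simp
    refine Finset.sum_congr rfl fun e' _ => ?_
    rw [Finset.mul_sum]
  rw [hex]
  refine Finset.sum_le_sum fun e _ => Finset.sum_le_sum fun e' _ => ?_
  exact mul_le_mul_of_nonneg_left (hpin e e') (mul_nonneg (hs e) (ht e'))

/-- **Exponential convolution through the triangle inequality.** On a finite index with a pseudo-distance `d` (nonnegative, triangle inequality) and
a uniform summability constant `C` for the kernel `e^{−μ d(x,·)}`: `Σ_{e,e'} e^{−2μ d(b,e)} e^{−2μ d(e,e')} e^{−2μ d(e',b')} ≤ C² · e^{−μ d(b,b')}`. -/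
theorem exp_convolution_le (d : E → E → ℝ) (μ C : ℝ) (hμ : 0 ≤ μ) (hd : ∀ x y, 0 ≤ d x y)
    (htri : ∀ x y z, d x z ≤ d x y + d y z)
    (hsum : ∀ x, ∑ y, Real.exp (-(μ * d x y)) ≤ C) (b b' : E) :
    ∑ e, ∑ e', Real.exp (-(2 * μ * d b e)) * Real.exp (-(2 * μ * d e e')) * Real.exp (-(2 * μ * d e' b')) ≤
      C ^ 2 * Real.exp (-(μ * d b b')) := by
  have hC : 0 ≤ C := le_trans (Finset.sum_nonneg fun y _ => (Real.exp_pos _).le) (hsum b)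
  have hpt : ∀ e e', Real.exp (-(2 * μ * d b e)) * Real.exp (-(2 * μ * d e e')) * Real.exp (-(2 * μ * d e' b')) ≤
      Real.exp (-(μ * d b b')) * (Real.exp (-(μ * d b e)) * Real.exp (-(μ * d e e'))) := by
    intro e e'
    have htri' : d b b' ≤ d b e + d e e' + d e' b' := by
      have h₁ := htri b e b'; have h₂ := htri e e' b'; linarith
    rw [← Real.exp_add, ← Real.exp_add, ← Real.exp_add, ← Real.exp_add, Real.exp_le_exp]
    have h1 := mul_le_mul_of_nonneg_left htri' hμ
    have h2 := mul_nonneg hμ (hd e' b')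
    have h3 := mul_nonneg hμ (hd b e)
    have h4 := mul_nonneg hμ (hd e e')
    nlinarith
  calc ∑ e, ∑ e', Real.exp (-(2 * μ * d b e)) * Real.exp (-(2 * μ * d e e')) * Real.exp (-(2 * μ * d e' b'))
      ≤ ∑ e, ∑ e', Real.exp (-(μ * d b b')) * (Real.exp (-(μ * d b e)) * Real.exp (-(μ * d e e'))) :=
        Finset.sum_le_sum fun e _ => Finset.sum_le_sum fun e' _ => hpt e e'
    _ = Real.exp (-(μ * d b b')) * ∑ e, Real.exp (-(μ * d b e)) * ∑ e', Real.exp (-(μ * d e e')) := by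
        rw [Finset.mul_sum]; refine Finset.sum_congr rfl fun e _ => ?_; rw [Finset.mul_sum, Finset.mul_sum]
    _ ≤ Real.exp (-(μ * d b b')) * ∑ e, Real.exp (-(μ * d b e)) * C := by
        refine mul_le_mul_of_nonneg_left (Finset.sum_le_sum fun e _ => ?_) (Real.exp_pos _).le
        exact mul_le_mul_of_nonneg_left (hsum e) (Real.exp_pos _).le
    _ = Real.exp (-(μ * d b b')) * ((∑ e, Real.exp (-(μ * d b e))) * C) := by rw [Finset.sum_mul]
    _ ≤ Real.exp (-(μ * d b b')) * (C * C) :=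
        mul_le_mul_of_nonneg_left (mul_le_mul_of_nonneg_right (hsum b) hC) (Real.exp_pos _).le
    _ = C ^ 2 * Real.exp (-(μ * d b b')) := by ring

end Summit.QuantumFields.YangMills.Cruxes.FluctuationComparisonRegPrIntL.RunPairOrgan.BackgroundFormAlgebra
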